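import Summits.BirchSwinnertonDyer.BirchSwinnertonDyer.Theorems.ResidualThetaTransportAtTwoAwayDefs
import HarnessLib

/-!
# ASSEMBLY clause C3 of the one-pair glue: RECIPROCITY on the supply datum — `pair (locd x) = 0` for every `x ∈ 𝐇¹`

Route `ResidualThetaTransportAtTwo` (RTT), crux RSL_g `ResidualSignedLambdaLowerCMAtTwo` (stmt-BirchSwinnertonDyer-22608), line «onepair» (v3d),
`Cruxes/ResidualSignedLambdaLowerCMAtTwo/ASSEMBLY-SPEC-g19.md` clause C3; LEAD `prover-bsd-wall-rtt-p2` g19 (`--supports 22608 --as helper`, closes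
nothing). THEOREMS ONLY (no definition, no named fact, no instance, no `sorry`). BSD is not proved by any of this; RSL_g is OPEN.

WHAT. The SUPPLY conjunct `hEH_Z : ∀ x ∈ Z, pair (locd x) = 0` holds on ALL of `𝐇¹` (a fortiori on `Z = Λ_𝒪 z`): with the supply pairing
`pair (F, χ) s = c̄₂ F s + ∑_w ∑ᶠ_c χ w c (locAway s w c)` and `locd x = (𝒸 x, locd_S x)`, the value at `x` is
`c̄₂ (𝒸 x) s + ∑∑ locd_S x w c (locAway s w c) = π₂.c₂ (locd₂ x) (loc₂ s) + ∑∑ … = 0` by the descent identity `c̄₂ (cN t) s = π₂.c₂ t (loc₂ s)`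
(S2's `pair₂` descended along `colN` + w2's `pair₂_eq_c₂_locKer`), `cN ∘ locd₂ = 𝒸`, and the registered reciprocity EH at `(π, π₂, πₐ)` (`Sg ⊆ SelRel`
by T1's `hSg`). Stated over the abstract coarsening `cN` / descended pairing `c̄₂` exactly as C2 (`OnePair.deepHalf_of_pins`).

* `OnePair.reciprocity_of_pins` — `∀ x s, c̄₂ (𝒸 x) s + ∑_w ∑ᶠ_c locd_S x w c (locAway s w c) = 0`.

References: [Kobayashi2003] Thm. 7.3 ((7.17)–(7.21)); [MilneADT2006] Ch. I, Thm. 4.10; [Kato2004Asterisque] Thm. 12.5.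
-/

set_option autoImplicit false
-- the Theorems namespace of this sub repeats the summit name by design (D-0017 nested layout)
set_option linter.dupNamespace false

noncomputable section

open scoped Classical

namespace Summit.BirchSwinnertonDyer.BirchSwinnertonDyer.Theorems.OnePair

open Literature.NumberTheory.EllipticCurves Literature.NumberTheory.EllipticCurves.GreenbergSelmer
open Literature.NumberTheory.GaloisRepresentations NumberField IsDedekindDomain Field
open Kobayashi2003 Rat.HeightOneSpectrum PowerSeries

variable {S : Set (PadicAlgCl 2)} {W : WeierstrassCurve ℚ} [W.IsElliptic] {κ : ZpExtension ℚ 2} {γ : absoluteGaloisGroup ℚ}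
  {S₀ : Finset (HeightOneSpectrum (𝓞 ℚ))} {n : ℕ} {ρ : FramedGaloisRep ℚ ↥(padicCoeffIntegers S) 2}
  {Θ : ∀ v : HeightOneSpectrum (𝓞 ℚ), ((2 : ℕ) : 𝓞 ℚ) ∈ v.asIdeal → (Cofree ρ ↥(padicCoeffField S) ≃+ (Fin n → ↥(W.geomPrimaryTorsion 2)))}
  {hΘ : ∀ v hv (δ : absoluteGaloisGroup (v.adicCompletion ℚ)) m i,
    Θ v hv (resGalOfEmb (closureEmb (K := ℚ) (v.adicCompletion ℚ)) δ • m) i = resGalOfEmb (closureEmb (K := ℚ) (v.adicCompletion ℚ)) δ • Θ v hv m i}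
  {I : Kato2004.IwasawaH1DataCoeff (FramedGaloisRep.toGaloisRep ρ) 2 κ γ}
  {Sg : AddSubgroup (subgroupH1 κ.kerSubgroup (Cofree ρ ↥(padicCoeffField S)))} [Module ↥(padicCoeffIntegers S) ↥Sg]
  (π : OnePairPins S W κ γ S₀ n ρ Θ hΘ I Sg) [Module ℤ_[2] (Dloc S κ ρ π.v)] (π₂ : AtTwoPins S κ ρ S₀ W γ n Θ hΘ I Sg π)
  [∀ w : ↥S₀, Module ℤ_[2] (Dloc S κ ρ (w : HeightOneSpectrum (𝓞 ℚ)))] (πₐ : AwayPins S κ ρ S₀ W γ n Θ hΘ I Sg π)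

/-- **C3 — reciprocity on the supply datum.** For every `x ∈ 𝐇¹` and `s ∈ Sg`:
`c̄₂ (𝒸 x) s + ∑_w ∑ᶠ_c locd_S x w c (locAway s w c) = 0` (EH at `(π, π₂, πₐ)` read through the descent identity and `cN ∘ locd₂ = 𝒸`).
[cite: Kobayashi2003, Thm. 7.3 ((7.17)–(7.21))] [cite: MilneADT2006, Ch. I, Thm. 4.10] -/
theorem reciprocity_of_pins
    (Eplus : AddSubgroup (Dloc S κ ρ π.v))
    (hSg : ∀ s : subgroupH1 κ.kerSubgroup (Cofree ρ ↥(padicCoeffField S)), s ∈ Sg ↔ s ∈ selRelSubgroup S κ ρ S₀ ∧ locKer S κ ρ π.v s ∈ Eplus)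
    (cN : ((Fin n → ↥(Sprung2012.localTowerPointsOfEmb κ (closureEmb (K := ℚ) (π.v.adicCompletion ℚ)) W)) →+ ℤ_[2]) →+
      (Fin n → PowerSeries ℤ_[2]))
    (hcvec : ∀ x : I.H, cN (π.locd₂ x) = π.cvec x)
    (c2bar : (Fin n → PowerSeries ℤ_[2]) →+ CharacterModule ↥Sg)
    (hc2bar : ∀ (t₀ : (Fin n → ↥(Sprung2012.localTowerPointsOfEmb κ (closureEmb (K := ℚ) (π.v.adicCompletion ℚ)) W)) →+ ℤ_[2]) (s : ↥Sg),
      c2bar (cN t₀) s = π₂.c₂ t₀ (locKer S κ ρ π.v (s : subgroupH1 κ.kerSubgroup (Cofree ρ ↥(padicCoeffField S)))))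
    (hEH : ∀ (x : I.H) (s : subgroupH1 κ.kerSubgroup (Cofree ρ ↥(padicCoeffField S))), s ∈ selRelSubgroup S κ ρ S₀ →
      π₂.c₂ (π.locd₂ x) (locKer S κ ρ π.v s) +
        ∑ w : ↥S₀, ∑ᶠ c : Cosets κ (w : HeightOneSpectrum (𝓞 ℚ)), πₐ.locdS x w c (locAway S κ ρ S₀ s w c) = 0)
    (x : I.H) (s : ↥Sg) :
    c2bar (π.cvec x) s +
      ∑ w : ↥S₀, ∑ᶠ c : Cosets κ (w : HeightOneSpectrum (𝓞 ℚ)),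
        πₐ.locdS x w c (locAway S κ ρ S₀ (s : subgroupH1 κ.kerSubgroup (Cofree ρ ↥(padicCoeffField S))) w c) = 0 := by
  rw [← hcvec, hc2bar]
  exact hEH x s ((hSg s).mp s.2).1

end Summit.BirchSwinnertonDyer.BirchSwinnertonDyer.Theorems.OnePair

end
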